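import Summits.Ventures.GridStability.Bench.CHIANG3Deg4ARecertDDeg4A8eqbLowh
import Summits.Ventures.GridStability.Lyapunov.CertificateSoundness
import Summits.Ventures.GridStability.Lyapunov.PolyRecastKeyedLie
import Summits.Ventures.GridStability.Lyapunov.PolyRecastEval
import Mathlib.Analysis.Calculus.Deriv.Pi
import Mathlib.Analysis.Normed.Module.FiniteDimension
import HarnessLib

/-!
# G1.a′+ «CHIANG3 deg-4»-roa (recast half): from the kernel-checked DEGREE-4 certificate
# `Bench/CHIANG3Deg4ARecertDDeg4A8eqbLowh` (toolchain A re-certification of sos-3's deg-4 claim instance, level 49199/50000) to invariance,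
# no pole slip and attraction of the certified sublevel piece FOR THE RECAST 3-machine MODEL M′

Venture GRIDFUSION, cell `gridfusion`, `plan/PARTITION.md` A2 (alg / roa), A5 (bridge), A6 (arc rule), A8 (rung G1.a′); lead g8
RULING 9i (7)(C) 2026-08-27T15:58:05Z (the «+» row of G1.a′ — cells R226/R272/R548 — gets its -roa pair); seat gridfusion-lyap-2 (g4),
generator `gen_chiang4.py` (HOME/lean/lyap-2/g4/) = g3's `gen_k2a4.py` (#50-roa `KUNDUR2ACSGDeg4AOwnVDeg4Nu4ibk3m1PpRoa` p540236)
re-pointed: `V` (150 monomials) — continuity and `V(0) = 0` from `Lyapunov/PolyRecastEval.lean` (p499980; one `decide` «no constant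
monomial»); the chain-rule link `V̇_poly = lieDeriv F V_poly` (365 terms, 1578 raw products of the six `∂_k V` (49–70 terms) with the
field components) decided in KEY SPACE by `Lyapunov/PolyRecastKeyedLie.lean` (p526803: `PolyRecast.lieCheckK 16 6 3 1 ΛA ΛB F V (−V̇) 6`,
ΛA = 10000000000 = lcm of the denominators of the `∂_k V`, ΛB = lcm of those of `F` (21 digits); ONE `decide +kernel`, all arithmetic
in `ℕ`). Companion of sos-5's kernel set `Bench/CHIANG3Deg4ARecertDDeg4A8eqbLowh{Data1–8, Psd1, Chk1, Part1–2, }.lean` (A file of record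
`cert/A/CHIANG3-deg4-A-recertD-deg4-A8eqb-lowh.json`, file sha256 `6a92736e6fd72f0c…`, sos-1 kit j262411 = toolchain-A re-certification of
sos-3's deg-4 claim instance `837e51104909b48c…`), whose decls it uses VERBATIM (`deg4_A_recertD_deg4_A8eqb_lowh_{f_<var>, h1, h2, V, Vdot}` +
`_poly` / `_eq`, and the four CERTIFIED identities `…_{V_pos, Vdot_neg, dom_incl_0, dom_incl_1}`). READ BACK before filing
(`gen_chiang4.py`, exact stdlib `fractions`): the TREE literals `…_V_poly` (150 terms), `…_Vdot_poly` (365), `…_f_<var>_poly`,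
`…_h{1,2}_poly` equal the A file's `lyapunov.V / Vdot`, `model.f / h` term for term AND the deg-2 companion's
`deg2_A_recertD_A8eqb_{f_<var>, h1, h2}_poly` (`Bench/CHIANG3Deg2ARecertDA8eqbData.lean`) term for term; `lieDeriv(F, V) = Vdot` EXACTLY;
`lieDeriv(F, h_j) = 0`; `ΛA·ΛB·Vdot` integral; digit bounds 3 + 1 < 16.

THREE COLUMNS. CERTIFIED (kernel, in the Bench files): on `{h = 0}`: `V ≥ (1/1000) φ`; on
`{h = 0} ∩ {V ≤ 49199/50000} ∩ {κ₁ ≤ 3/2} ∩ {κ₂ ≤ 3/2}`: `V̇ ≤ −(1/1000) φ`; on `{h = 0} ∩ {V ≤ 49199/50000}`: `κ₁ ≤ 3/2` and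
`κ₂ ≤ 3/2` (the sublevel piece lies inside the domain), with `φ = Σ z²` and the QUARTIC `V` of the file. MODELLED: every theorem of
THIS file is about the recast polynomial system `ż = F(z)` on `{h₁ = h₂ = 0} ⊂ ℝ⁶` — model-1's `Chiang3.field = Chiang3.data.infField`
(Chiang–Chu–Cauley 3-machine test system as typed by model-1 (`Models/Chiang3.lean`: machine 3 = reference / infinite bus, network-reduced classical model with LOSSLESS couplings — transfer conductances `G = 0`, susceptances `B = (1, 1/2, 1/2)`, unit voltages — damping `D = (2/5, 1/2)`, dimensionless `M = 1`; the word «lossy» in the Bench certificate file's header is a template slip, the typed data decide `G = 0`);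
instance CHIANG3 eq=b at the exact SEP per model-4 `bench/data/CHIANG3/equilibrium-A8.json` 643628c23212fc7c;
`z = (σ₁, κ₁, σ₂, κ₂, ω₁, ω₂)`, `σ_k = sin u_k`, `κ_k = 1 − cos u_k`, `u_k` = rotor-angle deviation of machine `k` from the
equilibrium, `ω_k` = speed deviation); MODEL-VALIDITY per model-2's CHIANG3 row. VALIDATED: nothing (the SDP data are provenance of
the Bench row; sos-3's comparison with the printed ROA figures of Chiang 2011 is that row's VALIDATED column — never the claim). No
sentence of this file says a machine or a grid is stable; «region of attraction» below means: the stated set of initial conditions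
OF THE MODEL M′ is carried to the model's equilibrium. The return to machine angles and speeds (`Chiang3.data.IsInfBusSolutionOn`)
is the sibling `…RoaModel.lean`.

STATEMENT (`deg4_A_recertD_deg4_A8eqb_lowh_roa`): for every `0 < γ ≤ 49199/50000` and every solution `z` of the recast system on `[0, ∞)` (Mathlib
sense: continuous, right derivative `F (z t)`) with `z 0 ∈ M = {h₁ = h₂ = 0}` and `V(z 0) ≤ γ`: `V(z t) ≤ γ` and `κ₁(t), κ₂(t) ≤
3/2` for all `t ≥ 0`, and `z t → 0`. Obligations: dissipation in bridge form (`LVz_le`, the domain hypotheses of `Vdot_neg`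
discharged by `dom_incl_0/1`), `W = (1/1000) φ` positive definite (`eq_zero_of_Wz`, `Wz_pos`), compactness from `V_pos` (`φ ≤ 1000·c
< 1024`, `‖z‖∞ ≤ 32`), the chain rule (keyed link) and the two first integrals via `PolyRecast`, then
`Lyapunov.certificate_invariance_tendsto_univ`; plus the gauge bound `W ≤ V` on `M` (`phi_le_V`) for downstream RATE
(`Lyapunov/CertificateDecay`) / inner-ball readings.
-/

namespace Summit.Ventures.GridStability.Bench.CHIANG3

open Set Filter Metric Topology Real
open Summit.Ventures.GridStability.Lyapunov
open Literature.Computation.Certificates Literature.Computation.Certificates.SOS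

noncomputable section

/-! ### Recast phase space `Fin 6 → ℝ`, coordinates in the certificate's variable order ['sigma_1', 'kappa_1', 'sigma_2', 'kappa_2', 'omega_1', 'omega_2'] -/

/-- The recast field of the instance on `Fin 6 → ℝ` (components = the Bench decls verbatim).
MODELLED column. [folklore] -/
def deg4_A_recertD_deg4_A8eqb_lowh_F (z : Fin 6 → ℝ) : Fin 6 → ℝ :=
  ![deg4_A_recertD_deg4_A8eqb_lowh_f_sigma_1 (z 0) (z 1) (z 2) (z 3) (z 4) (z 5),
    deg4_A_recertD_deg4_A8eqb_lowh_f_kappa_1 (z 0) (z 1) (z 2) (z 3) (z 4) (z 5),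
    deg4_A_recertD_deg4_A8eqb_lowh_f_sigma_2 (z 0) (z 1) (z 2) (z 3) (z 4) (z 5),
    deg4_A_recertD_deg4_A8eqb_lowh_f_kappa_2 (z 0) (z 1) (z 2) (z 3) (z 4) (z 5),
    deg4_A_recertD_deg4_A8eqb_lowh_f_omega_1 (z 0) (z 1) (z 2) (z 3) (z 4) (z 5),
    deg4_A_recertD_deg4_A8eqb_lowh_f_omega_2 (z 0) (z 1) (z 2) (z 3) (z 4) (z 5)]

/-- The certificate's `V` on the phase space. [folklore] -/
def deg4_A_recertD_deg4_A8eqb_lowh_Vz (z : Fin 6 → ℝ) : ℝ := deg4_A_recertD_deg4_A8eqb_lowh_V (z 0) (z 1) (z 2) (z 3) (z 4) (z 5)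

/-- Its Lie derivative `∇V·f` (the emitted `Vdot`). [folklore] -/
def deg4_A_recertD_deg4_A8eqb_lowh_LVz (z : Fin 6 → ℝ) : ℝ := deg4_A_recertD_deg4_A8eqb_lowh_Vdot (z 0) (z 1) (z 2) (z 3) (z 4) (z 5)

/-- The certified dissipation rate `W = ε_dot·φ` (`φ = Σ z²`, written in the Bench theorem's term order). [folklore] -/
def deg4_A_recertD_deg4_A8eqb_lowh_Wz (z : Fin 6 → ℝ) : ℝ := ((1 : ℝ) / 1000) * ((1 : ℝ) * z 5 ^ 2 + (1 : ℝ) * z 4 ^ 2 + (1 : ℝ) * z 3 ^ 2 + (1 : ℝ) * z 2 ^ 2 + (1 : ℝ) * z 1 ^ 2 + (1 : ℝ) * z 0 ^ 2)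

/-- The recast constraint set `M = {h_j = 0}`. [folklore] -/
def deg4_A_recertD_deg4_A8eqb_lowh_M : Set (Fin 6 → ℝ) := {z | deg4_A_recertD_deg4_A8eqb_lowh_h1 (z 0) (z 1) (z 2) (z 3) (z 4) (z 5) = 0 ∧ deg4_A_recertD_deg4_A8eqb_lowh_h2 (z 0) (z 1) (z 2) (z 3) (z 4) (z 5) = 0}

/-- The certificate's level `c = 49199/50000`. [folklore] -/
def deg4_A_recertD_deg4_A8eqb_lowh_level : ℝ := ((49199 : ℝ) / 50000)

/-- Component `0` (`sigma_1`) of the recast field. [folklore] -/ @[simp] theorem deg4_A_recertD_deg4_A8eqb_lowh_F_0 (z : Fin 6 → ℝ) : deg4_A_recertD_deg4_A8eqb_lowh_F z 0 = deg4_A_recertD_deg4_A8eqb_lowh_f_sigma_1 (z 0) (z 1) (z 2) (z 3) (z 4) (z 5) := rfl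
/-- Component `1` (`kappa_1`) of the recast field. [folklore] -/ @[simp] theorem deg4_A_recertD_deg4_A8eqb_lowh_F_1 (z : Fin 6 → ℝ) : deg4_A_recertD_deg4_A8eqb_lowh_F z 1 = deg4_A_recertD_deg4_A8eqb_lowh_f_kappa_1 (z 0) (z 1) (z 2) (z 3) (z 4) (z 5) := rfl
/-- Component `2` (`sigma_2`) of the recast field. [folklore] -/ @[simp] theorem deg4_A_recertD_deg4_A8eqb_lowh_F_2 (z : Fin 6 → ℝ) : deg4_A_recertD_deg4_A8eqb_lowh_F z 2 = deg4_A_recertD_deg4_A8eqb_lowh_f_sigma_2 (z 0) (z 1) (z 2) (z 3) (z 4) (z 5) := rfl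
/-- Component `3` (`kappa_2`) of the recast field. [folklore] -/ @[simp] theorem deg4_A_recertD_deg4_A8eqb_lowh_F_3 (z : Fin 6 → ℝ) : deg4_A_recertD_deg4_A8eqb_lowh_F z 3 = deg4_A_recertD_deg4_A8eqb_lowh_f_kappa_2 (z 0) (z 1) (z 2) (z 3) (z 4) (z 5) := rfl
/-- Component `4` (`omega_1`) of the recast field. [folklore] -/ @[simp] theorem deg4_A_recertD_deg4_A8eqb_lowh_F_4 (z : Fin 6 → ℝ) : deg4_A_recertD_deg4_A8eqb_lowh_F z 4 = deg4_A_recertD_deg4_A8eqb_lowh_f_omega_1 (z 0) (z 1) (z 2) (z 3) (z 4) (z 5) := rfl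
/-- Component `5` (`omega_2`) of the recast field. [folklore] -/ @[simp] theorem deg4_A_recertD_deg4_A8eqb_lowh_F_5 (z : Fin 6 → ℝ) : deg4_A_recertD_deg4_A8eqb_lowh_F z 5 = deg4_A_recertD_deg4_A8eqb_lowh_f_omega_2 (z 0) (z 1) (z 2) (z 3) (z 4) (z 5) := rfl

/-! ### `V` on the phase space: generic route `Lyapunov/PolyRecastEval.lean` (no unfolding of the 150 monomials) -/

/-- `Vz` is the kernel polynomial `V_poly` read on the phase space through `vars (List.ofFn ·)`. [folklore] -/
theorem deg4_A_recertD_deg4_A8eqb_lowh_Vz_eq_eval (w : Fin 6 → ℝ) :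
    deg4_A_recertD_deg4_A8eqb_lowh_Vz w = Poly.eval (vars (List.ofFn w)) deg4_A_recertD_deg4_A8eqb_lowh_V_poly := by
  simp [deg4_A_recertD_deg4_A8eqb_lowh_Vz, deg4_A_recertD_deg4_A8eqb_lowh_V]

/-- `V` is continuous on the phase space (`PolyRecast.continuous_eval_ofFn`). [folklore] -/
theorem deg4_A_recertD_deg4_A8eqb_lowh_continuous_Vz : Continuous deg4_A_recertD_deg4_A8eqb_lowh_Vz := by
  have e : deg4_A_recertD_deg4_A8eqb_lowh_Vz = fun w ↦ Poly.eval (vars (List.ofFn w)) deg4_A_recertD_deg4_A8eqb_lowh_V_poly := by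
    funext w; exact deg4_A_recertD_deg4_A8eqb_lowh_Vz_eq_eval w
  rw [e]
  exact PolyRecast.continuous_eval_ofFn _

set_option maxRecDepth 100000 in
/-- Every monomial of `V_poly` has a nonzero exponent (no constant term; one kernel `decide` on the literal). [folklore] -/
theorem deg4_A_recertD_deg4_A8eqb_lowh_V_noConst : (deg4_A_recertD_deg4_A8eqb_lowh_V_poly.all fun t => t.1.any fun e => decide (e ≠ 0)) = true := by
  decide +kernel

/-- `V(0) = 0` (`PolyRecast.eval_ofFn_zero_of_all`). [folklore] -/
theorem deg4_A_recertD_deg4_A8eqb_lowh_Vz_zero : deg4_A_recertD_deg4_A8eqb_lowh_Vz 0 = 0 := by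
  rw [deg4_A_recertD_deg4_A8eqb_lowh_Vz_eq_eval]
  exact PolyRecast.eval_ofFn_zero_of_all _ deg4_A_recertD_deg4_A8eqb_lowh_V_noConst

/-! ### Algebraic consequences of the certified identities -/

/-- Arc exclusion (A6) on the certified piece: `kappa_1 ≤ 3/2`. CERTIFIED input: `deg4_A_recertD_deg4_A8eqb_lowh_dom_incl_0`. [folklore] -/
theorem deg4_A_recertD_deg4_A8eqb_lowh_arc_kappa_1 {z : Fin 6 → ℝ} (hz : z ∈ deg4_A_recertD_deg4_A8eqb_lowh_M) (hV : deg4_A_recertD_deg4_A8eqb_lowh_Vz z ≤ deg4_A_recertD_deg4_A8eqb_lowh_level) :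
    z 1 ≤ ((3 : ℝ) / 2) := by
  have h := deg4_A_recertD_deg4_A8eqb_lowh_dom_incl_0 (z 0) (z 1) (z 2) (z 3) (z 4) (z 5) hV hz.1 hz.2
  linarith

/-- Arc exclusion (A6) on the certified piece: `kappa_2 ≤ 3/2`. CERTIFIED input: `deg4_A_recertD_deg4_A8eqb_lowh_dom_incl_1`. [folklore] -/
theorem deg4_A_recertD_deg4_A8eqb_lowh_arc_kappa_2 {z : Fin 6 → ℝ} (hz : z ∈ deg4_A_recertD_deg4_A8eqb_lowh_M) (hV : deg4_A_recertD_deg4_A8eqb_lowh_Vz z ≤ deg4_A_recertD_deg4_A8eqb_lowh_level) :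
    z 3 ≤ ((3 : ℝ) / 2) := by
  have h := deg4_A_recertD_deg4_A8eqb_lowh_dom_incl_1 (z 0) (z 1) (z 2) (z 3) (z 4) (z 5) hV hz.1 hz.2
  linarith

/-- Dissipation inequality in bridge form on `M ∩ {V ≤ c}`: `LV ≤ −W` (the two domain hypotheses of the
Bench theorem discharged by `dom_incl_0/1`). CERTIFIED inputs: `deg4_A_recertD_deg4_A8eqb_lowh_Vdot_neg`, `…dom_incl_0`, `…dom_incl_1`. [folklore] -/
theorem deg4_A_recertD_deg4_A8eqb_lowh_LVz_le {z : Fin 6 → ℝ} (hz : z ∈ deg4_A_recertD_deg4_A8eqb_lowh_M) (hV : deg4_A_recertD_deg4_A8eqb_lowh_Vz z ≤ deg4_A_recertD_deg4_A8eqb_lowh_level) :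
    deg4_A_recertD_deg4_A8eqb_lowh_LVz z ≤ -deg4_A_recertD_deg4_A8eqb_lowh_Wz z := by
  have h := deg4_A_recertD_deg4_A8eqb_lowh_Vdot_neg (z 0) (z 1) (z 2) (z 3) (z 4) (z 5) hV (deg4_A_recertD_deg4_A8eqb_lowh_dom_incl_0 (z 0) (z 1) (z 2) (z 3) (z 4) (z 5) hV hz.1 hz.2)
    (deg4_A_recertD_deg4_A8eqb_lowh_dom_incl_1 (z 0) (z 1) (z 2) (z 3) (z 4) (z 5) hV hz.1 hz.2) hz.1 hz.2
  simp only [deg4_A_recertD_deg4_A8eqb_lowh_LVz, deg4_A_recertD_deg4_A8eqb_lowh_Wz]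
  linarith

/-- `W = ε·φ` is positive definite: its only zero is the origin. [folklore] -/
theorem deg4_A_recertD_deg4_A8eqb_lowh_eq_zero_of_Wz {z : Fin 6 → ℝ} (hW : deg4_A_recertD_deg4_A8eqb_lowh_Wz z = 0) : z = 0 := by
  simp only [deg4_A_recertD_deg4_A8eqb_lowh_Wz] at hW
  have e0 : z 0 = 0 := (pow_eq_zero_iff two_ne_zero).mp (le_antisymm (by linarith [sq_nonneg (z 1), sq_nonneg (z 2), sq_nonneg (z 3), sq_nonneg (z 4), sq_nonneg (z 5)]) (sq_nonneg _))
  have e1 : z 1 = 0 := (pow_eq_zero_iff two_ne_zero).mp (le_antisymm (by linarith [sq_nonneg (z 0), sq_nonneg (z 2), sq_nonneg (z 3), sq_nonneg (z 4), sq_nonneg (z 5)]) (sq_nonneg _))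
  have e2 : z 2 = 0 := (pow_eq_zero_iff two_ne_zero).mp (le_antisymm (by linarith [sq_nonneg (z 0), sq_nonneg (z 1), sq_nonneg (z 3), sq_nonneg (z 4), sq_nonneg (z 5)]) (sq_nonneg _))
  have e3 : z 3 = 0 := (pow_eq_zero_iff two_ne_zero).mp (le_antisymm (by linarith [sq_nonneg (z 0), sq_nonneg (z 1), sq_nonneg (z 2), sq_nonneg (z 4), sq_nonneg (z 5)]) (sq_nonneg _))
  have e4 : z 4 = 0 := (pow_eq_zero_iff two_ne_zero).mp (le_antisymm (by linarith [sq_nonneg (z 0), sq_nonneg (z 1), sq_nonneg (z 2), sq_nonneg (z 3), sq_nonneg (z 5)]) (sq_nonneg _))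
  have e5 : z 5 = 0 := (pow_eq_zero_iff two_ne_zero).mp (le_antisymm (by linarith [sq_nonneg (z 0), sq_nonneg (z 1), sq_nonneg (z 2), sq_nonneg (z 3), sq_nonneg (z 4)]) (sq_nonneg _))
  funext i
  fin_cases i <;> simp [e0, e1, e2, e3, e4, e5]

/-- Strictness on every level surface `{V = γ}`, `γ > 0`: `W > 0` there. [folklore] -/
theorem deg4_A_recertD_deg4_A8eqb_lowh_Wz_pos {z : Fin 6 → ℝ} {γ : ℝ} (hγ0 : 0 < γ) (hV : deg4_A_recertD_deg4_A8eqb_lowh_Vz z = γ) :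
    0 < deg4_A_recertD_deg4_A8eqb_lowh_Wz z := by
  have hW0 : 0 ≤ deg4_A_recertD_deg4_A8eqb_lowh_Wz z := by simp only [deg4_A_recertD_deg4_A8eqb_lowh_Wz]; positivity
  rcases hW0.lt_or_eq with h | h
  · exact h
  · exfalso
    have hz0 := deg4_A_recertD_deg4_A8eqb_lowh_eq_zero_of_Wz h.symm
    subst hz0
    rw [deg4_A_recertD_deg4_A8eqb_lowh_Vz_zero] at hV
    linarith

/-- **The certified lower bound `W ≤ V` on `M`** in phase-space form (`ε_pos = ε_dot = 1/1000`, `φ = Σ z²`): the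
positivity identity of the Bench file (`deg4_A_recertD_deg4_A8eqb_lowh_V_pos`) — the gauge bound behind compactness, and the input of
`Lyapunov/CertificateDecay` for a future RATE rider and of any Euclidean inner-ball reading. [folklore] -/
theorem deg4_A_recertD_deg4_A8eqb_lowh_phi_le_V {z : Fin 6 → ℝ} (hz : z ∈ deg4_A_recertD_deg4_A8eqb_lowh_M) :
    deg4_A_recertD_deg4_A8eqb_lowh_Wz z ≤ deg4_A_recertD_deg4_A8eqb_lowh_Vz z := by
  have h := deg4_A_recertD_deg4_A8eqb_lowh_V_pos (z 0) (z 1) (z 2) (z 3) (z 4) (z 5) hz.1 hz.2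
  simp only [deg4_A_recertD_deg4_A8eqb_lowh_Wz, deg4_A_recertD_deg4_A8eqb_lowh_Vz]
  linarith

/-- Compactness of the certified piece `S = {z ∈ M | V z ≤ c}` (closed; bounded through `V_pos`:
`(1/1000)·Σz² ≤ V ≤ c < 1`, hence `‖z‖∞ ≤ 32`). [folklore] -/
theorem deg4_A_recertD_deg4_A8eqb_lowh_isCompact_S : IsCompact {z ∈ deg4_A_recertD_deg4_A8eqb_lowh_M | deg4_A_recertD_deg4_A8eqb_lowh_Vz z ≤ deg4_A_recertD_deg4_A8eqb_lowh_level} := by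
  have hMc : IsClosed deg4_A_recertD_deg4_A8eqb_lowh_M := by
    simp only [deg4_A_recertD_deg4_A8eqb_lowh_M, deg4_A_recertD_deg4_A8eqb_lowh_h1_eq, deg4_A_recertD_deg4_A8eqb_lowh_h2_eq]
    exact (isClosed_eq (by fun_prop) continuous_const).inter
      (isClosed_eq (by fun_prop) continuous_const)
  have h := isCompact_sublevel_of_norm_le (D := univ) (c := deg4_A_recertD_deg4_A8eqb_lowh_level) (R := (32 : ℝ)) hMc
    isClosed_univ deg4_A_recertD_deg4_A8eqb_lowh_continuous_Vz.continuousOn ?_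
  · rwa [inter_univ] at h
  rintro z ⟨hz, -⟩ hV
  have hpos := deg4_A_recertD_deg4_A8eqb_lowh_phi_le_V hz
  simp only [deg4_A_recertD_deg4_A8eqb_lowh_Wz] at hpos
  have hc : deg4_A_recertD_deg4_A8eqb_lowh_Vz z ≤ 1 := hV.trans (by unfold deg4_A_recertD_deg4_A8eqb_lowh_level; norm_num)
  have hb0 : |z 0| ≤ (32 : ℝ) := abs_le.2 (abs_le_of_sq_le_sq' (by nlinarith [sq_nonneg (z 1), sq_nonneg (z 2), sq_nonneg (z 3), sq_nonneg (z 4), sq_nonneg (z 5)]) (by norm_num))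
  have hb1 : |z 1| ≤ (32 : ℝ) := abs_le.2 (abs_le_of_sq_le_sq' (by nlinarith [sq_nonneg (z 0), sq_nonneg (z 2), sq_nonneg (z 3), sq_nonneg (z 4), sq_nonneg (z 5)]) (by norm_num))
  have hb2 : |z 2| ≤ (32 : ℝ) := abs_le.2 (abs_le_of_sq_le_sq' (by nlinarith [sq_nonneg (z 0), sq_nonneg (z 1), sq_nonneg (z 3), sq_nonneg (z 4), sq_nonneg (z 5)]) (by norm_num))
  have hb3 : |z 3| ≤ (32 : ℝ) := abs_le.2 (abs_le_of_sq_le_sq' (by nlinarith [sq_nonneg (z 0), sq_nonneg (z 1), sq_nonneg (z 2), sq_nonneg (z 4), sq_nonneg (z 5)]) (by norm_num))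
  have hb4 : |z 4| ≤ (32 : ℝ) := abs_le.2 (abs_le_of_sq_le_sq' (by nlinarith [sq_nonneg (z 0), sq_nonneg (z 1), sq_nonneg (z 2), sq_nonneg (z 3), sq_nonneg (z 5)]) (by norm_num))
  have hb5 : |z 5| ≤ (32 : ℝ) := abs_le.2 (abs_le_of_sq_le_sq' (by nlinarith [sq_nonneg (z 0), sq_nonneg (z 1), sq_nonneg (z 2), sq_nonneg (z 3), sq_nonneg (z 4)]) (by norm_num))
  refine (pi_norm_le_iff_of_nonneg (by norm_num)).2 fun i ↦ ?_
  rw [Real.norm_eq_abs]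
  fin_cases i
  · simpa using hb0
  · simpa using hb1
  · simpa using hb2
  · simpa using hb3
  · simpa using hb4
  · simpa using hb5

/-! ### Calculus along a solution of the recast system (keyed Lie link `Lyapunov/PolyRecastKeyedLie.lean`) -/

/-- The recast field as the list of its `Poly` literals (the Bench decls, in coordinate order). [folklore] -/
def deg4_A_recertD_deg4_A8eqb_lowh_Flit : List Poly := [deg4_A_recertD_deg4_A8eqb_lowh_f_sigma_1_poly, deg4_A_recertD_deg4_A8eqb_lowh_f_kappa_1_poly, deg4_A_recertD_deg4_A8eqb_lowh_f_sigma_2_poly, deg4_A_recertD_deg4_A8eqb_lowh_f_kappa_2_poly, deg4_A_recertD_deg4_A8eqb_lowh_f_omega_1_poly, deg4_A_recertD_deg4_A8eqb_lowh_f_omega_2_poly]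

/-- `V` has 6 variables (`numVars` = longest exponent vector; one `decide`). [folklore] -/
theorem deg4_A_recertD_deg4_A8eqb_lowh_V_numVars : Poly.numVars deg4_A_recertD_deg4_A8eqb_lowh_V_poly = 6 := by decide +kernel

/-- The two integer scalings are positive: `ΛA` (11 digits) clears the denominators of every `∂_k V`,
`ΛB` (21 digits) those of every field component; `ΛA·ΛB` clears those of `V̇`. [folklore] -/
theorem deg4_A_recertD_deg4_A8eqb_lowh_scalings_pos : 0 < 10000000000 * 593138883746693796010 := by norm_num

set_option maxRecDepth 100000 in
/-- **The certificate's `Vdot` polynomial IS the Lie derivative of `V` along `f`**, decided in KEY SPACE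
(`PolyRecast.lieCheckK`, base-16 Kronecker keys, sign–magnitude integer coefficients, digit bounds 3 + 1 < 16):
the 1578 products `(ΛA·∂_k V) × (ΛB·F_k)` (k = 0 … 5) and the 365 terms of `ΛA·ΛB·(−V̇)` merge-sort into key
groups that all sum to ZERO — i.e. `lieDeriv F V = −(−V̇) = V̇` as polynomial functions
(`eval_lieDeriv_eq_neg_of_lieCheckK`). ONE `decide +kernel`, all arithmetic in `ℕ`. [folklore] -/
theorem deg4_A_recertD_deg4_A8eqb_lowh_vdot_linkK :
    PolyRecast.lieCheckK 16 6 3 1 10000000000 593138883746693796010 deg4_A_recertD_deg4_A8eqb_lowh_Flit deg4_A_recertD_deg4_A8eqb_lowh_V_poly (Poly.neg deg4_A_recertD_deg4_A8eqb_lowh_Vdot_poly) 6 = true := by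
  decide +kernel

/-- Coordinatewise form of a solution of the recast system, in the `PolyRecast` vocabulary. [folklore] -/
theorem deg4_A_recertD_deg4_A8eqb_lowh_hasDerivWithinAt_coord {z : ℝ → Fin 6 → ℝ} {t : ℝ} {s : Set ℝ}
    (hz : HasDerivWithinAt z (deg4_A_recertD_deg4_A8eqb_lowh_F (z t)) s t) (i : Fin 6) :
    HasDerivWithinAt (fun τ ↦ z τ i)
      (Poly.eval (vars (List.ofFn (z t))) (deg4_A_recertD_deg4_A8eqb_lowh_Flit.getD i [])) s t := by
  have h := (hasDerivWithinAt_pi.1 hz) i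
  fin_cases i <;> simpa [deg4_A_recertD_deg4_A8eqb_lowh_Flit, deg4_A_recertD_deg4_A8eqb_lowh_F, deg4_A_recertD_deg4_A8eqb_lowh_f_sigma_1, deg4_A_recertD_deg4_A8eqb_lowh_f_kappa_1, deg4_A_recertD_deg4_A8eqb_lowh_f_sigma_2, deg4_A_recertD_deg4_A8eqb_lowh_f_kappa_2, deg4_A_recertD_deg4_A8eqb_lowh_f_omega_1, deg4_A_recertD_deg4_A8eqb_lowh_f_omega_2] using h

/-- **Chain rule**: along a curve with right derivative `F (z t)`, `V ∘ z` has derivative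
`LV (z t) = Vdot(z t)` (`PolyRecast.hasDerivWithinAt_eval_neg_of_lieCheckK` with `Rp := −V̇_poly`). [folklore] -/
theorem deg4_A_recertD_deg4_A8eqb_lowh_hasDerivWithinAt_Vz {z : ℝ → Fin 6 → ℝ} {t : ℝ} {s : Set ℝ}
    (hz : HasDerivWithinAt z (deg4_A_recertD_deg4_A8eqb_lowh_F (z t)) s t) :
    HasDerivWithinAt (deg4_A_recertD_deg4_A8eqb_lowh_Vz ∘ z) (deg4_A_recertD_deg4_A8eqb_lowh_LVz (z t)) s t := by
  have h := PolyRecast.hasDerivWithinAt_eval_neg_of_lieCheckK (Fp := deg4_A_recertD_deg4_A8eqb_lowh_Flit) (N' := 6)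
    (by simp [deg4_A_recertD_deg4_A8eqb_lowh_Flit]) deg4_A_recertD_deg4_A8eqb_lowh_vdot_linkK deg4_A_recertD_deg4_A8eqb_lowh_V_numVars deg4_A_recertD_deg4_A8eqb_lowh_scalings_pos
    (deg4_A_recertD_deg4_A8eqb_lowh_hasDerivWithinAt_coord hz)
  have e1 : deg4_A_recertD_deg4_A8eqb_lowh_Vz ∘ z = fun τ ↦ Poly.eval (vars (List.ofFn (z τ))) deg4_A_recertD_deg4_A8eqb_lowh_V_poly := by
    funext τ; simp [deg4_A_recertD_deg4_A8eqb_lowh_Vz, deg4_A_recertD_deg4_A8eqb_lowh_V]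
  have e2 : deg4_A_recertD_deg4_A8eqb_lowh_LVz (z t) = -Poly.eval (vars (List.ofFn (z t))) (Poly.neg deg4_A_recertD_deg4_A8eqb_lowh_Vdot_poly) := by
    rw [Poly.eval_neg, neg_neg]
    simp [deg4_A_recertD_deg4_A8eqb_lowh_LVz, deg4_A_recertD_deg4_A8eqb_lowh_Vdot]
  rw [e1, e2]
  exact h

/-- `deg4_A_recertD_deg4_A8eqb_lowh_h1` has zero Lie derivative along `f` (one `decide`). [folklore] -/
theorem deg4_A_recertD_deg4_A8eqb_lowh_h1_isFirstIntegral : Poly.isZero (Poly.lieDeriv deg4_A_recertD_deg4_A8eqb_lowh_Flit deg4_A_recertD_deg4_A8eqb_lowh_h1_poly) = true := by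
  decide +kernel

/-- **`deg4_A_recertD_deg4_A8eqb_lowh_h1` is a first integral** of the recast field: `deg4_A_recertD_deg4_A8eqb_lowh_h1 ∘ z` has right derivative `0`. [folklore] -/
theorem deg4_A_recertD_deg4_A8eqb_lowh_hasDerivWithinAt_h1 {z : ℝ → Fin 6 → ℝ} {t : ℝ} {s : Set ℝ}
    (hz : HasDerivWithinAt z (deg4_A_recertD_deg4_A8eqb_lowh_F (z t)) s t) :
    HasDerivWithinAt (fun τ ↦ deg4_A_recertD_deg4_A8eqb_lowh_h1 (z τ 0) (z τ 1) (z τ 2) (z τ 3) (z τ 4) (z τ 5)) 0 s t := by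
  have h := PolyRecast.hasDerivWithinAt_eval_zero_of_isZero (Fp := deg4_A_recertD_deg4_A8eqb_lowh_Flit) (N := 6) (by simp [deg4_A_recertD_deg4_A8eqb_lowh_Flit])
    deg4_A_recertD_deg4_A8eqb_lowh_h1_isFirstIntegral (deg4_A_recertD_deg4_A8eqb_lowh_hasDerivWithinAt_coord hz)
  have e : (fun τ ↦ deg4_A_recertD_deg4_A8eqb_lowh_h1 (z τ 0) (z τ 1) (z τ 2) (z τ 3) (z τ 4) (z τ 5))
      = fun τ ↦ Poly.eval (vars (List.ofFn (z τ))) deg4_A_recertD_deg4_A8eqb_lowh_h1_poly := by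
    funext τ; simp [deg4_A_recertD_deg4_A8eqb_lowh_h1]
  rw [e]
  exact h

/-- `deg4_A_recertD_deg4_A8eqb_lowh_h2` has zero Lie derivative along `f` (one `decide`). [folklore] -/
theorem deg4_A_recertD_deg4_A8eqb_lowh_h2_isFirstIntegral : Poly.isZero (Poly.lieDeriv deg4_A_recertD_deg4_A8eqb_lowh_Flit deg4_A_recertD_deg4_A8eqb_lowh_h2_poly) = true := by
  decide +kernel

/-- **`deg4_A_recertD_deg4_A8eqb_lowh_h2` is a first integral** of the recast field: `deg4_A_recertD_deg4_A8eqb_lowh_h2 ∘ z` has right derivative `0`. [folklore] -/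
theorem deg4_A_recertD_deg4_A8eqb_lowh_hasDerivWithinAt_h2 {z : ℝ → Fin 6 → ℝ} {t : ℝ} {s : Set ℝ}
    (hz : HasDerivWithinAt z (deg4_A_recertD_deg4_A8eqb_lowh_F (z t)) s t) :
    HasDerivWithinAt (fun τ ↦ deg4_A_recertD_deg4_A8eqb_lowh_h2 (z τ 0) (z τ 1) (z τ 2) (z τ 3) (z τ 4) (z τ 5)) 0 s t := by
  have h := PolyRecast.hasDerivWithinAt_eval_zero_of_isZero (Fp := deg4_A_recertD_deg4_A8eqb_lowh_Flit) (N := 6) (by simp [deg4_A_recertD_deg4_A8eqb_lowh_Flit])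
    deg4_A_recertD_deg4_A8eqb_lowh_h2_isFirstIntegral (deg4_A_recertD_deg4_A8eqb_lowh_hasDerivWithinAt_coord hz)
  have e : (fun τ ↦ deg4_A_recertD_deg4_A8eqb_lowh_h2 (z τ 0) (z τ 1) (z τ 2) (z τ 3) (z τ 4) (z τ 5))
      = fun τ ↦ Poly.eval (vars (List.ofFn (z τ))) deg4_A_recertD_deg4_A8eqb_lowh_h2_poly := by
    funext τ; simp [deg4_A_recertD_deg4_A8eqb_lowh_h2]
  rw [e]
  exact h

/-- A solution of the recast system starting on `M` stays on `M` (the constraints are first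
integrals). [folklore] -/
theorem deg4_A_recertD_deg4_A8eqb_lowh_mem_M {z : ℝ → Fin 6 → ℝ} (hzc : ContinuousOn z (Ici 0))
    (hz : ∀ t, 0 ≤ t → HasDerivWithinAt z (deg4_A_recertD_deg4_A8eqb_lowh_F (z t)) (Ici t) t)
    (h0 : z 0 ∈ deg4_A_recertD_deg4_A8eqb_lowh_M) : ∀ t, 0 ≤ t → z t ∈ deg4_A_recertD_deg4_A8eqb_lowh_M := by
  intro T hT
  have hc0 : ContinuousOn (fun τ ↦ deg4_A_recertD_deg4_A8eqb_lowh_h1 (z τ 0) (z τ 1) (z τ 2) (z τ 3) (z τ 4) (z τ 5)) (Icc 0 T) := by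
    have hc : Continuous fun y : Fin 6 → ℝ ↦ deg4_A_recertD_deg4_A8eqb_lowh_h1 (y 0) (y 1) (y 2) (y 3) (y 4) (y 5) := by
      simp only [deg4_A_recertD_deg4_A8eqb_lowh_h1_eq]; fun_prop
    exact hc.comp_continuousOn (hzc.mono fun s hs ↦ hs.1)
  have k0 := constant_of_has_deriv_right_zero hc0
    (fun t ht ↦ deg4_A_recertD_deg4_A8eqb_lowh_hasDerivWithinAt_h1 (hz t ht.1)) T ⟨hT, le_rfl⟩
  have z0 : deg4_A_recertD_deg4_A8eqb_lowh_h1 (z 0 0) (z 0 1) (z 0 2) (z 0 3) (z 0 4) (z 0 5) = 0 := h0.1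
  have hc1 : ContinuousOn (fun τ ↦ deg4_A_recertD_deg4_A8eqb_lowh_h2 (z τ 0) (z τ 1) (z τ 2) (z τ 3) (z τ 4) (z τ 5)) (Icc 0 T) := by
    have hc : Continuous fun y : Fin 6 → ℝ ↦ deg4_A_recertD_deg4_A8eqb_lowh_h2 (y 0) (y 1) (y 2) (y 3) (y 4) (y 5) := by
      simp only [deg4_A_recertD_deg4_A8eqb_lowh_h2_eq]; fun_prop
    exact hc.comp_continuousOn (hzc.mono fun s hs ↦ hs.1)
  have k1 := constant_of_has_deriv_right_zero hc1
    (fun t ht ↦ deg4_A_recertD_deg4_A8eqb_lowh_hasDerivWithinAt_h2 (hz t ht.1)) T ⟨hT, le_rfl⟩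
  have z1 : deg4_A_recertD_deg4_A8eqb_lowh_h2 (z 0 0) (z 0 1) (z 0 2) (z 0 3) (z 0 4) (z 0 5) = 0 := h0.2
  exact ⟨by show deg4_A_recertD_deg4_A8eqb_lowh_h1 (z T 0) (z T 1) (z T 2) (z T 3) (z T 4) (z T 5) = 0; rw [k0, z0], by show deg4_A_recertD_deg4_A8eqb_lowh_h2 (z T 0) (z T 1) (z T 2) (z T 3) (z T 4) (z T 5) = 0; rw [k1, z1]⟩

/-! ### The ROA inclusion for the recast model -/

/-- **G1.a′+ «CHIANG3 deg-4»-roa (recast coordinates).** MODELLED: the recast polynomial system `ż = F(z)`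
on `{h = 0} ⊂ ℝ⁶` of the instance (model-1's `Chiang3.field`, interface I2; MODEL-VALIDITY row of the Bench file).
CERTIFIED inputs: the kernel-checked identities of the Bench files. STATEMENT: for every level `0 < γ ≤ c = 49199/50000`
and every solution `z` on `[0, ∞)` (Mathlib sense: continuous, right derivative `F (z t)`) with `z 0 ∈ M`, `V(z 0) ≤ γ`:
`V(z t) ≤ γ` and the arc bounds `κ₁, κ₂ ≤ 3/2` for all `t ≥ 0`, and `z t → 0`. Via
`Lyapunov.certificate_invariance_tendsto_univ`. No sentence here says a machine or a grid is stable. [folklore] -/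
theorem deg4_A_recertD_deg4_A8eqb_lowh_roa {γ : ℝ} (hγ0 : 0 < γ) (hγ : γ ≤ deg4_A_recertD_deg4_A8eqb_lowh_level) {z : ℝ → Fin 6 → ℝ}
    (hzc : ContinuousOn z (Ici 0))
    (hz : ∀ t, 0 ≤ t → HasDerivWithinAt z (deg4_A_recertD_deg4_A8eqb_lowh_F (z t)) (Ici t) t)
    (h0M : z 0 ∈ deg4_A_recertD_deg4_A8eqb_lowh_M) (h0V : deg4_A_recertD_deg4_A8eqb_lowh_Vz (z 0) ≤ γ) :
    (∀ t, 0 ≤ t → deg4_A_recertD_deg4_A8eqb_lowh_Vz (z t) ≤ γ ∧ z t 1 ≤ ((3 : ℝ) / 2) ∧ z t 3 ≤ ((3 : ℝ) / 2)) ∧ Tendsto z atTop (𝓝 0) := by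
  have hF : Continuous deg4_A_recertD_deg4_A8eqb_lowh_F := by
    refine continuous_pi fun i ↦ ?_
    fin_cases i <;> simp [deg4_A_recertD_deg4_A8eqb_lowh_F, deg4_A_recertD_deg4_A8eqb_lowh_f_sigma_1_eq, deg4_A_recertD_deg4_A8eqb_lowh_f_kappa_1_eq, deg4_A_recertD_deg4_A8eqb_lowh_f_sigma_2_eq, deg4_A_recertD_deg4_A8eqb_lowh_f_kappa_2_eq, deg4_A_recertD_deg4_A8eqb_lowh_f_omega_1_eq, deg4_A_recertD_deg4_A8eqb_lowh_f_omega_2_eq] <;> fun_prop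
  have hV : Continuous deg4_A_recertD_deg4_A8eqb_lowh_Vz := deg4_A_recertD_deg4_A8eqb_lowh_continuous_Vz
  have hW : Continuous deg4_A_recertD_deg4_A8eqb_lowh_Wz := by unfold deg4_A_recertD_deg4_A8eqb_lowh_Wz; fun_prop
  have h0 : (0 : Fin 6 → ℝ) ∈ deg4_A_recertD_deg4_A8eqb_lowh_M := by simp [deg4_A_recertD_deg4_A8eqb_lowh_M, deg4_A_recertD_deg4_A8eqb_lowh_h1_eq, deg4_A_recertD_deg4_A8eqb_lowh_h2_eq]
  have hMc : IsClosed deg4_A_recertD_deg4_A8eqb_lowh_M := by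
    simp only [deg4_A_recertD_deg4_A8eqb_lowh_M, deg4_A_recertD_deg4_A8eqb_lowh_h1_eq, deg4_A_recertD_deg4_A8eqb_lowh_h2_eq]
    exact (isClosed_eq (by fun_prop) continuous_const).inter
      (isClosed_eq (by fun_prop) continuous_const)
  have hSγ : IsCompact {y ∈ deg4_A_recertD_deg4_A8eqb_lowh_M | deg4_A_recertD_deg4_A8eqb_lowh_Vz y ≤ γ} :=
    deg4_A_recertD_deg4_A8eqb_lowh_isCompact_S.of_isClosed_subset (hMc.inter (isClosed_le hV continuous_const))
      (fun y hy ↦ ⟨hy.1, hy.2.trans hγ⟩)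
  have h := certificate_invariance_tendsto_univ (M := deg4_A_recertD_deg4_A8eqb_lowh_M) (LV := deg4_A_recertD_deg4_A8eqb_lowh_LVz) (W := deg4_A_recertD_deg4_A8eqb_lowh_Wz)
    (x₀ := 0) hSγ hF.continuousOn hV.continuousOn hW.continuousOn
    (fun y hy hVy ↦ deg4_A_recertD_deg4_A8eqb_lowh_LVz_le hy (hVy.trans hγ))
    (fun y _ _ ↦ by simp only [deg4_A_recertD_deg4_A8eqb_lowh_Wz]; positivity)
    (fun y _ hVy ↦ deg4_A_recertD_deg4_A8eqb_lowh_Wz_pos hγ0 hVy)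
    h0 (by rw [deg4_A_recertD_deg4_A8eqb_lowh_Vz_zero]; exact hγ0.le) (by simp [deg4_A_recertD_deg4_A8eqb_lowh_Wz])
    (fun y _ _ hWy ↦ deg4_A_recertD_deg4_A8eqb_lowh_eq_zero_of_Wz hWy)
    hzc hz (fun t ht ↦ deg4_A_recertD_deg4_A8eqb_lowh_hasDerivWithinAt_Vz (hz t ht)) (deg4_A_recertD_deg4_A8eqb_lowh_mem_M hzc hz h0M) h0V
  have hM := deg4_A_recertD_deg4_A8eqb_lowh_mem_M hzc hz h0M
  exact ⟨fun t ht ↦ ⟨h.1 t ht, deg4_A_recertD_deg4_A8eqb_lowh_arc_kappa_1 (hM t ht) ((h.1 t ht).trans hγ), deg4_A_recertD_deg4_A8eqb_lowh_arc_kappa_2 (hM t ht) ((h.1 t ht).trans hγ)⟩, h.2⟩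

end

end Summit.Ventures.GridStability.Bench.CHIANG3
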